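import Literature.Analysis.FluidPDE.BurgersVortex
import Literature.Analysis.FluidPDE.LoopCirculation
import HarnessLib

/-!
# The circulation of the Burgers vortex around coaxial horizontal circles — a core-ledger read-out tool

Cell `ns-blowup`, seat `ns-palasek-19179-p2` (g5; holder of crux `EpisodeBase`, stmt-NavierStokesRegularity-19179);
FluidComputer tool file over the Literature modules `BurgersVortex.lean` and `LoopCirculation.lean` (sibling of
ecbridge-4 g6's `PalasekTowerBurgersLayerCircle.lean`, which does the same for the Burgers LAYER). LABEL: E–C / MODEL
arithmetic (KERNEL, exact identities for an explicit steady profile). WHAT THIS IS NOT: not Navier–Stokes evidence —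
the Burgers vortex is an infinite-energy exact profile and no registered stage. For the Burgers vortex swirl
`v(x) = (Γ/2πr²)(1 − e^{−γr²/4ν})(−x₁, x₀, 0)` (Gallay–Maekawa 2016, (1.21)–(1.22)) and the
horizontal circle `circleLoop 0 ρ e₀ e₁` of radius `ρ` about the axis (`e₀, e₁` the first two
coordinate vectors), the circulation is the Lamb–Oseen / Burgers flux through the disc:

  `∮ v · dℓ = Γ · (1 − e^{−γρ²/(4ν)})`      (`circulation_burgersVortexSwirl_circleLoop`),

and the strain part `U_s = (−γx₀/2, −γx₁/2, γx₂)` contributes nothing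
(`circulation_axisymmetricStrain_circleLoop`), so the full Burgers field has the same circulation
(`circulation_burgersVortex_circleLoop`). Elementary: on the circle the swirl is `f(ρ²) · J x` with
`J x` the (un-normalised) tangent, so the integrand of `circulation_circleLoop` is the constant
`Γ(1 − e^{−γρ²/4ν})/(2π)`. (Saffman 1992, §13.1: the circulation inside radius `r` of the Burgers
vortex is `Γ(1 − e^{−γr²/4ν})`.) `e₀, e₁` are written out as `EuclideanSpace.single 0 1`, `EuclideanSpace.single 1 1`. Also recorded: the circle's points have norm `|ρ|` and its
velocity norm `2π|ρ|` (`norm_circleLoop_axis`, `norm_deriv_circleLoop_axis`) — the two side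
conditions of core-ledger-type loop clauses.

References: P. G. Saffman, *Vortex Dynamics* (CUP 1992) §13.1 (3)–(4) [cite: Saffman1992, §13.1 eq. (3)];
Th. Gallay, Y. Maekawa, arXiv:1610.08384, (1.21)–(1.22) [cite: GallayMaekawa2016, (1.21)–(1.22)].
-/

noncomputable section

open Set Function Filter Topology WithLp MeasureTheory Real
open scoped InnerProductSpace RealInnerProductSpace ContDiff

namespace Summit.NavierStokesRegularity.FluidComputer.PalasekTowerClayBridge

open Literature.Analysis.FluidPDE


/-- Coordinates of the horizontal point `a e₀ + b e₁`. [folklore] -/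
theorem horizPoint_apply (a b : ℝ) :
    (a • (EuclideanSpace.single (0 : Fin 3) (1 : ℝ) : EuclideanSpace ℝ (Fin 3)) + b • (EuclideanSpace.single (1 : Fin 3) (1 : ℝ) : EuclideanSpace ℝ (Fin 3))) 0 = a ∧ (a • (EuclideanSpace.single (0 : Fin 3) (1 : ℝ) : EuclideanSpace ℝ (Fin 3)) + b • (EuclideanSpace.single (1 : Fin 3) (1 : ℝ) : EuclideanSpace ℝ (Fin 3))) 1 = b ∧ (a • (EuclideanSpace.single (0 : Fin 3) (1 : ℝ) : EuclideanSpace ℝ (Fin 3)) + b • (EuclideanSpace.single (1 : Fin 3) (1 : ℝ) : EuclideanSpace ℝ (Fin 3))) 2 = 0 := by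
  refine ⟨?_, ?_, ?_⟩ <;> simp

/-- The rotation generator turns the radius vector of the circle into its tangent:
`J((ρ cos θ) e₀ + (ρ sin θ) e₁) = (−ρ sin θ) e₀ + (ρ cos θ) e₁`. [folklore] -/
theorem rotGen_horizPoint (a b : ℝ) : rotGen (a • (EuclideanSpace.single (0 : Fin 3) (1 : ℝ) : EuclideanSpace ℝ (Fin 3)) + b • (EuclideanSpace.single (1 : Fin 3) (1 : ℝ) : EuclideanSpace ℝ (Fin 3))) = (-b) • (EuclideanSpace.single (0 : Fin 3) (1 : ℝ) : EuclideanSpace ℝ (Fin 3)) + a • (EuclideanSpace.single (1 : Fin 3) (1 : ℝ) : EuclideanSpace ℝ (Fin 3)) := by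
  obtain ⟨h0, h1, -⟩ := horizPoint_apply a b
  ext i
  fin_cases i
  · simp [rotGen_apply_zero, h1]
  · simp [rotGen_apply_one, h0]
  · simp [rotGen_apply_two]

/-- `‖a e₀ + b e₁‖² = a² + b²`. [folklore] -/
theorem norm_horizPoint_sq (a b : ℝ) : ‖a • (EuclideanSpace.single (0 : Fin 3) (1 : ℝ) : EuclideanSpace ℝ (Fin 3)) + b • (EuclideanSpace.single (1 : Fin 3) (1 : ℝ) : EuclideanSpace ℝ (Fin 3))‖ ^ 2 = a ^ 2 + b ^ 2 := by
  obtain ⟨h0, h1, h2⟩ := horizPoint_apply a b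
  rw [EuclideanSpace.norm_eq, Real.sq_sqrt (Finset.sum_nonneg fun i _ => sq_nonneg _),
    Fin.sum_univ_three, h0, h1, h2]
  simp

/-- `‖a e₀ + b e₁‖ = √(a² + b²)`. [folklore] -/
theorem norm_horizPoint (a b : ℝ) : ‖a • (EuclideanSpace.single (0 : Fin 3) (1 : ℝ) : EuclideanSpace ℝ (Fin 3)) + b • (EuclideanSpace.single (1 : Fin 3) (1 : ℝ) : EuclideanSpace ℝ (Fin 3))‖ = Real.sqrt (a ^ 2 + b ^ 2) := by
  rw [← norm_horizPoint_sq, Real.sqrt_sq (norm_nonneg _)]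

/-- Points of the horizontal circle of radius `ρ` about the axis have norm `|ρ|`. [folklore] -/
theorem norm_circleLoop_axis (ρ s : ℝ) : ‖circleLoop (0 : EuclideanSpace ℝ (Fin 3)) ρ (EuclideanSpace.single (0 : Fin 3) (1 : ℝ) : EuclideanSpace ℝ (Fin 3)) (EuclideanSpace.single (1 : Fin 3) (1 : ℝ) : EuclideanSpace ℝ (Fin 3)) s‖ = |ρ| := by
  rw [circleLoop_apply, zero_add, norm_horizPoint]
  have h : (ρ * cos (2 * π * s)) ^ 2 + (ρ * sin (2 * π * s)) ^ 2 = ρ ^ 2 := by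
    nlinarith [sin_sq_add_cos_sq (2 * π * s)]
  rw [h, Real.sqrt_sq_eq_abs]

/-- The velocity of the horizontal circle of radius `ρ` has norm `2π|ρ|`. [folklore] -/
theorem norm_deriv_circleLoop_axis (ρ s : ℝ) : ‖deriv (circleLoop (0 : EuclideanSpace ℝ (Fin 3)) ρ (EuclideanSpace.single (0 : Fin 3) (1 : ℝ) : EuclideanSpace ℝ (Fin 3)) (EuclideanSpace.single (1 : Fin 3) (1 : ℝ) : EuclideanSpace ℝ (Fin 3))) s‖ = 2 * π * |ρ| := by
  rw [deriv_circleLoop, norm_smul, show (-(ρ * sin (2 * π * s))) • (EuclideanSpace.single (0 : Fin 3) (1 : ℝ) : EuclideanSpace ℝ (Fin 3)) + (ρ * cos (2 * π * s)) • (EuclideanSpace.single (1 : Fin 3) (1 : ℝ) : EuclideanSpace ℝ (Fin 3)) =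
      (-(ρ * sin (2 * π * s))) • (EuclideanSpace.single (0 : Fin 3) (1 : ℝ) : EuclideanSpace ℝ (Fin 3)) + (ρ * cos (2 * π * s)) • (EuclideanSpace.single (1 : Fin 3) (1 : ℝ) : EuclideanSpace ℝ (Fin 3)) from rfl, norm_horizPoint]
  have h : (-(ρ * sin (2 * π * s))) ^ 2 + (ρ * cos (2 * π * s)) ^ 2 = ρ ^ 2 := by
    nlinarith [sin_sq_add_cos_sq (2 * π * s)]
  rw [h, Real.sqrt_sq_eq_abs, Real.norm_eq_abs, abs_of_pos (by positivity : (0 : ℝ) < 2 * π)]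

/-- **The circulation integrand of the Burgers swirl on a coaxial circle is constant**: at the point
`x = (ρ cos θ) e₀ + (ρ sin θ) e₁`, `ρ ≠ 0`, `γ, ν ≠ 0`,
`⟪v(x), (−ρ sin θ) e₀ + (ρ cos θ) e₁⟫ = Γ (1 − e^{−γρ²/(4ν)}) / (2π)`. [cite: GallayMaekawa2016, (1.21)–(1.22)] -/
theorem inner_burgersVortexSwirl_tangent {γ ν : ℝ} (hγ : γ ≠ 0) (hν : ν ≠ 0) (Γ : ℝ) {ρ : ℝ}
    (hρ : ρ ≠ 0) (θ : ℝ) :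
    ⟪burgersVortexSwirl γ ν Γ ((ρ * cos θ) • (EuclideanSpace.single (0 : Fin 3) (1 : ℝ) : EuclideanSpace ℝ (Fin 3)) + (ρ * sin θ) • (EuclideanSpace.single (1 : Fin 3) (1 : ℝ) : EuclideanSpace ℝ (Fin 3))),
      (-(ρ * sin θ)) • (EuclideanSpace.single (0 : Fin 3) (1 : ℝ) : EuclideanSpace ℝ (Fin 3)) + (ρ * cos θ) • (EuclideanSpace.single (1 : Fin 3) (1 : ℝ) : EuclideanSpace ℝ (Fin 3))⟫ =
      Γ * (1 - Real.exp (-(γ * ρ ^ 2 / (4 * ν)))) / (2 * π) := by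
  obtain ⟨h0, h1, -⟩ := horizPoint_apply (ρ * cos θ) (ρ * sin θ)
  have hr2 : ((ρ * cos θ) • (EuclideanSpace.single (0 : Fin 3) (1 : ℝ) : EuclideanSpace ℝ (Fin 3)) + (ρ * sin θ) • (EuclideanSpace.single (1 : Fin 3) (1 : ℝ) : EuclideanSpace ℝ (Fin 3))) 0 ^ 2 + ((ρ * cos θ) • (EuclideanSpace.single (0 : Fin 3) (1 : ℝ) : EuclideanSpace ℝ (Fin 3)) + (ρ * sin θ) • (EuclideanSpace.single (1 : Fin 3) (1 : ℝ) : EuclideanSpace ℝ (Fin 3))) 1 ^ 2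
      = ρ ^ 2 := by
    rw [h0, h1]; nlinarith [sin_sq_add_cos_sq θ]
  have hx : ((ρ * cos θ) • (EuclideanSpace.single (0 : Fin 3) (1 : ℝ) : EuclideanSpace ℝ (Fin 3)) + (ρ * sin θ) • (EuclideanSpace.single (1 : Fin 3) (1 : ℝ) : EuclideanSpace ℝ (Fin 3))) 0 ^ 2 + ((ρ * cos θ) • (EuclideanSpace.single (0 : Fin 3) (1 : ℝ) : EuclideanSpace ℝ (Fin 3)) + (ρ * sin θ) • (EuclideanSpace.single (1 : Fin 3) (1 : ℝ) : EuclideanSpace ℝ (Fin 3))) 1 ^ 2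
      ≠ 0 := by rw [hr2]; positivity
  rw [burgersVortexSwirl_eq_of_ne_zero hγ hν Γ hx, hr2, rotGen_horizPoint, real_inner_smul_left,
    real_inner_self_eq_norm_sq, norm_horizPoint_sq]
  have ht : (-(ρ * sin θ)) ^ 2 + (ρ * cos θ) ^ 2 = ρ ^ 2 := by nlinarith [sin_sq_add_cos_sq θ]
  rw [ht]
  field_simp

/-- **CIRCULATION OF THE BURGERS SWIRL AROUND A COAXIAL CIRCLE**: for `γ, ν ≠ 0` and any radius `ρ`,
`∮_{circleLoop 0 ρ e₀ e₁} v · dℓ = Γ · (1 − e^{−γρ²/(4ν)})` — the circulation enclosed within radius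
`ρ` (Saffman 1992 §13.1). [cite: Saffman1992, §13.1 eq. (3)] -/
theorem circulation_burgersVortexSwirl_circleLoop {γ ν : ℝ} (hγ : γ ≠ 0) (hν : ν ≠ 0) (Γ ρ : ℝ) :
    circulation (burgersVortexSwirl γ ν Γ) (circleLoop (0 : EuclideanSpace ℝ (Fin 3)) ρ (EuclideanSpace.single (0 : Fin 3) (1 : ℝ) : EuclideanSpace ℝ (Fin 3)) (EuclideanSpace.single (1 : Fin 3) (1 : ℝ) : EuclideanSpace ℝ (Fin 3))) =
      Γ * (1 - Real.exp (-(γ * ρ ^ 2 / (4 * ν)))) := by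
  rcases eq_or_ne ρ 0 with hρ | hρ
  · subst hρ
    simp [circulation]
  rw [circulation_circleLoop]
  simp_rw [zero_add, inner_burgersVortexSwirl_tangent hγ hν Γ hρ]
  rw [intervalIntegral.integral_const, smul_eq_mul]
  have hπ : (π : ℝ) ≠ 0 := Real.pi_ne_zero
  field_simp
  ring

/-- **The axisymmetric strain has zero circulation around coaxial horizontal circles** (its
horizontal part is radial). [folklore] -/
theorem circulation_axisymmetricStrain_circleLoop (γ ρ : ℝ) :
    circulation (axisymmetricStrain γ) (circleLoop (0 : EuclideanSpace ℝ (Fin 3)) ρ (EuclideanSpace.single (0 : Fin 3) (1 : ℝ) : EuclideanSpace ℝ (Fin 3)) (EuclideanSpace.single (1 : Fin 3) (1 : ℝ) : EuclideanSpace ℝ (Fin 3))) = 0 := by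
  rw [circulation_circleLoop]
  have h : ∀ θ : ℝ, ⟪axisymmetricStrain γ ((ρ * cos θ) • (EuclideanSpace.single (0 : Fin 3) (1 : ℝ) : EuclideanSpace ℝ (Fin 3)) + (ρ * sin θ) • (EuclideanSpace.single (1 : Fin 3) (1 : ℝ) : EuclideanSpace ℝ (Fin 3))),
      (-(ρ * sin θ)) • (EuclideanSpace.single (0 : Fin 3) (1 : ℝ) : EuclideanSpace ℝ (Fin 3)) + (ρ * cos θ) • (EuclideanSpace.single (1 : Fin 3) (1 : ℝ) : EuclideanSpace ℝ (Fin 3))⟫ = 0 := by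
    intro θ
    obtain ⟨h0, h1, -⟩ := horizPoint_apply (ρ * cos θ) (ρ * sin θ)
    obtain ⟨t0, t1, t2⟩ := horizPoint_apply (-(ρ * sin θ)) (ρ * cos θ)
    have hin : ∀ u v : EuclideanSpace ℝ (Fin 3), ⟪u, v⟫ = u 0 * v 0 + u 1 * v 1 + u 2 * v 2 := fun u v => by
      simp only [PiLp.inner_apply, Fin.sum_univ_three, RCLike.inner_apply, conj_trivial]; ring
    rw [hin, t0, t1, t2]
    simp only [axisymmetricStrain, linearStrain_apply_zero, linearStrain_apply_one, linearStrain_apply_two]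
    rw [h0, h1]
    ring
  simp_rw [zero_add, h]
  simp

/-- **CIRCULATION OF THE FULL BURGERS VORTEX AROUND A COAXIAL CIRCLE**: the strain adds nothing, so
`∮ (U_s + v) · dℓ = Γ · (1 − e^{−γρ²/(4ν)})`. [cite: Saffman1992, §13.1 eq. (3)] -/
theorem circulation_burgersVortex_circleLoop {γ ν : ℝ} (hγ : γ ≠ 0) (hν : ν ≠ 0) (Γ ρ : ℝ) :
    circulation (burgersVortex γ ν Γ) (circleLoop (0 : EuclideanSpace ℝ (Fin 3)) ρ (EuclideanSpace.single (0 : Fin 3) (1 : ℝ) : EuclideanSpace ℝ (Fin 3)) (EuclideanSpace.single (1 : Fin 3) (1 : ℝ) : EuclideanSpace ℝ (Fin 3))) =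
      Γ * (1 - Real.exp (-(γ * ρ ^ 2 / (4 * ν)))) := by
  rw [burgersVortex, circulation_add_left ((contDiff_axisymmetricStrain γ (n := 1)).continuous)
      ((contDiff_burgersVortexSwirl γ ν Γ (n := 1)).continuous) (contDiff_circleLoop _ _ _ _),
    circulation_axisymmetricStrain_circleLoop, circulation_burgersVortexSwirl_circleLoop hγ hν, zero_add]

end Summit.NavierStokesRegularity.FluidComputer.PalasekTowerClayBridge

end
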